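import Summits.CriticalPhenomena.Ising3D.TaylorOddConeQPoly
import Mathlib.Algebra.BigOperators.Group.Finset.Sigma
import Mathlib.Tactic.Linarith
import Mathlib.Tactic.Positivity
import Mathlib.Tactic.Ring
import HarnessLib

/-!
# The shifted Euler–rapidity majorant: the Ψ family of rc0 (D5b) as named Taylor functionals
(cell `pub-ising3x`, seat recog-1 gen 10; producer recipe for the majorant `Ψ` of `TaylorConeObligations` —
the family PRICED by experiment M-g1 (HOME/pub-ising3x-recog-1/gen9/M-G1-RESULT.md v3.2, boot-1 MG1-LOG.md):
`ν₃(E,j) = Σ u_{mk} (E - E_T)^m h_k(j)`, `u ≥ 0`, realised at the Taylor-coefficient level;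
HOME/pub-ising3x-recog-1/gen10/CONE-LAYER.md §4)

HONEST FRAMING: lottery ticket; floor = tightest certified 3D Ising CFT bounds; no exact-solution
claim without a proof.

* `shiftedEulerRapidityWeight x c m k a b = Σ_{r≤m} C(m,r) (-c)^{m-r} · eulerRapidityWeight x r k a b` — the
  Taylor weights at `(x,x)` of `(D - c)^m A^{2k}` (`D = x∂ₓ + y∂_y`, `A = x∂ₓ - y∂_y`); on the Legendre
  monomial: `Σ_{a,b≤N} W · taylorCoeffAt x x (a,b) 𝒫_{E,j} = x^E (E - c)^m hMoment k j` (`m + 2k ≤ N`, `j ≤ E`;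
  recog-1 g9's `sum_eulerRapidityWeight_taylorCoeffAt_zMono` + the binomial theorem).
* `eulerMajorantWeight x c T u (a,b) = Σ_{(m,k)∈T} u(m,k) · shiftedEulerRapidityWeight x c m k a b` on the index
  square `eulerIndexSet N`: the functional `Ψ_u = Σ_{ab} ψ(ab) · taylorCoeffAt x x ab` — literally the shape
  `boxExcluded_of_taylorConeObligations_half` consumes — with
  `Ψ_u(𝒫_{E,j}) = x^E Σ_{(m,k)∈T} u(m,k) (E - c)^m hMoment k j` (`sum_eulerMajorantWeight_taylorCoeffAt_zMono`),
  non-negative for `u ≥ 0`, `E ≥ c` (`eulerMajorantValue_nonneg`); at `x = ½`: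
  `qSum ψ (eulerIndexSet N) 0 0 E j = Σ u (E - c)^m hMoment k j` (`qSum_eulerMajorantWeight_zero_zero`).
* `qM_half_of_eulerDomination`: obligation (M̂) of `oddConeAt_half_of_qCone` for `Ψ_u` from COEFFICIENT
  DOMINATION `|c₃(m,k)| ≤ u(m,k)`, GIVEN the expansion `(½)^{Δσ+Δε} q̂₃(E,j) = Σ c₃(m,k) (E - c)^m hMoment k j`
  as a hypothesis (the `(E, h_k)`-polynomial form of the row-3 q-sum — true by the kernel form and the symmetry of
  the antidiagonal average, but NOT yet a tree theorem; until it is, a table checks (M̂) directly or via the kernel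
  form (KM) of `TaylorOddConeKernel`).
Sources: elementary (finite sums).
-/

namespace Summit.CriticalPhenomena.Ising3D

open Finset Set
open Literature.MathematicalPhysics.QuantumFieldTheory.ConformalBootstrap3D

/-! ### Shifted Euler–rapidity weights -/

/-- Taylor weights of `(D - c)^m A^{2k}` at `(x,x)`: `Σ_{r ≤ m} C(m,r) (-c)^{m-r} · eulerRapidityWeight x r k a b`.
[folklore] -/
noncomputable def shiftedEulerRapidityWeight (x c : ℝ) (m k a b : ℕ) : ℝ :=
  ∑ r ∈ range (m + 1), (m.choose r : ℝ) * (-c) ^ (m - r) * eulerRapidityWeight x r k a b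

/-- **`(D - c)^m A^{2k}` is diagonal on the Legendre monomials**: for `0 < x < 1`, `j ≤ E`, `m + 2k ≤ N`,
`Σ_{a,b ≤ N} shiftedEulerRapidityWeight x c m k a b · taylorCoeffAt x x (a,b) 𝒫_{E,j} = x^E (E - c)^m hMoment k j`.
[folklore] -/
theorem sum_shiftedEulerRapidityWeight_taylorCoeffAt_zMono {x : ℝ} (hx0 : 0 < x) (hx1 : x < 1) (c : ℝ)
    {E : ℝ} {j : ℕ} (hEj : (j : ℝ) ≤ E) {m k N : ℕ} (hN : m + 2 * k ≤ N) :
    ∑ a ∈ range (N + 1), ∑ b ∈ range (N + 1),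
        shiftedEulerRapidityWeight x c m k a b * taylorCoeffAt x x (a, b) (zMono E j) =
      x ^ E * ((E - c) ^ m * hMoment k j) := by
  have hstep : ∀ r ∈ range (m + 1), ∑ a ∈ range (N + 1), ∑ b ∈ range (N + 1),
      eulerRapidityWeight x r k a b * taylorCoeffAt x x (a, b) (zMono E j) = x ^ E * (E ^ r * hMoment k j) := by
    intro r hr
    simp only [Finset.mem_range] at hr
    exact sum_eulerRapidityWeight_taylorCoeffAt_zMono hx0 hx1 hEj (by omega)
  have hexp : ∑ r ∈ range (m + 1), (m.choose r : ℝ) * (-c) ^ (m - r) * E ^ r = (E - c) ^ m := by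
    rw [sub_eq_add_neg, add_pow]
    exact Finset.sum_congr rfl fun r _ => by ring
  calc ∑ a ∈ range (N + 1), ∑ b ∈ range (N + 1),
          shiftedEulerRapidityWeight x c m k a b * taylorCoeffAt x x (a, b) (zMono E j)
      = ∑ a ∈ range (N + 1), ∑ b ∈ range (N + 1), ∑ r ∈ range (m + 1),
          (m.choose r : ℝ) * (-c) ^ (m - r) *
            (eulerRapidityWeight x r k a b * taylorCoeffAt x x (a, b) (zMono E j)) := by
        refine Finset.sum_congr rfl fun a _ => Finset.sum_congr rfl fun b _ => ?_
        rw [shiftedEulerRapidityWeight, Finset.sum_mul]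
        exact Finset.sum_congr rfl fun r _ => by ring
    _ = ∑ a ∈ range (N + 1), ∑ r ∈ range (m + 1), ∑ b ∈ range (N + 1),
          (m.choose r : ℝ) * (-c) ^ (m - r) *
            (eulerRapidityWeight x r k a b * taylorCoeffAt x x (a, b) (zMono E j)) :=
        Finset.sum_congr rfl fun a _ => Finset.sum_comm
    _ = ∑ r ∈ range (m + 1), ∑ a ∈ range (N + 1), ∑ b ∈ range (N + 1),
          (m.choose r : ℝ) * (-c) ^ (m - r) *
            (eulerRapidityWeight x r k a b * taylorCoeffAt x x (a, b) (zMono E j)) := Finset.sum_comm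
    _ = ∑ r ∈ range (m + 1), (m.choose r : ℝ) * (-c) ^ (m - r) *
          ∑ a ∈ range (N + 1), ∑ b ∈ range (N + 1),
            eulerRapidityWeight x r k a b * taylorCoeffAt x x (a, b) (zMono E j) := by
        refine Finset.sum_congr rfl fun r _ => ?_
        rw [Finset.mul_sum]
        refine Finset.sum_congr rfl fun a _ => ?_
        rw [Finset.mul_sum]
    _ = ∑ r ∈ range (m + 1), (m.choose r : ℝ) * (-c) ^ (m - r) * (x ^ E * (E ^ r * hMoment k j)) :=
        Finset.sum_congr rfl fun r hr => by rw [hstep r hr]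
    _ = x ^ E * hMoment k j * ∑ r ∈ range (m + 1), (m.choose r : ℝ) * (-c) ^ (m - r) * E ^ r := by
        rw [Finset.mul_sum]
        exact Finset.sum_congr rfl fun r _ => by ring
    _ = x ^ E * ((E - c) ^ m * hMoment k j) := by rw [hexp]; ring

/-! ### The majorant functional of the family -/

/-- The index square `{(a,b) : a, b ≤ N}`. [folklore] -/
def eulerIndexSet (N : ℕ) : Finset (ℕ × ℕ) := range (N + 1) ×ˢ range (N + 1)

/-- The Taylor weights of `Ψ_u = Σ_{(m,k)∈T} u(m,k) (D - c)^m A^{2k}` at `(x,x)`. [folklore] -/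
noncomputable def eulerMajorantWeight (x c : ℝ) (T : Finset (ℕ × ℕ)) (u : ℕ × ℕ → ℝ) (ab : ℕ × ℕ) : ℝ :=
  ∑ mk ∈ T, u mk * shiftedEulerRapidityWeight x c mk.1 mk.2 ab.1 ab.2

/-- **`Ψ_u` on the Legendre monomials**: for `0 < x < 1`, `j ≤ E` and `m + 2k ≤ N` on `T`,
`Ψ_u(𝒫_{E,j}) = x^E Σ_{(m,k)∈T} u(m,k) (E - c)^m hMoment k j`. [folklore] -/
theorem sum_eulerMajorantWeight_taylorCoeffAt_zMono {x : ℝ} (hx0 : 0 < x) (hx1 : x < 1) (c : ℝ)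
    {E : ℝ} {j : ℕ} (hEj : (j : ℝ) ≤ E) {N : ℕ} {T : Finset (ℕ × ℕ)}
    (hT : ∀ mk ∈ T, mk.1 + 2 * mk.2 ≤ N) (u : ℕ × ℕ → ℝ) :
    (∑ ab ∈ eulerIndexSet N, eulerMajorantWeight x c T u ab • taylorCoeffAt x x ab) (zMono E j) =
      x ^ E * ∑ mk ∈ T, u mk * ((E - c) ^ mk.1 * hMoment mk.2 j) := by
  rw [LinearMap.sum_apply]
  simp only [LinearMap.smul_apply, smul_eq_mul]
  rw [eulerIndexSet, Finset.sum_product]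
  calc ∑ a ∈ range (N + 1), ∑ b ∈ range (N + 1),
          eulerMajorantWeight x c T u (a, b) * taylorCoeffAt x x (a, b) (zMono E j)
      = ∑ a ∈ range (N + 1), ∑ b ∈ range (N + 1), ∑ mk ∈ T,
          u mk * (shiftedEulerRapidityWeight x c mk.1 mk.2 a b * taylorCoeffAt x x (a, b) (zMono E j)) := by
        refine Finset.sum_congr rfl fun a _ => Finset.sum_congr rfl fun b _ => ?_
        rw [eulerMajorantWeight, Finset.sum_mul]
        exact Finset.sum_congr rfl fun mk _ => by ring
    _ = ∑ a ∈ range (N + 1), ∑ mk ∈ T, ∑ b ∈ range (N + 1),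
          u mk * (shiftedEulerRapidityWeight x c mk.1 mk.2 a b * taylorCoeffAt x x (a, b) (zMono E j)) :=
        Finset.sum_congr rfl fun a _ => Finset.sum_comm
    _ = ∑ mk ∈ T, ∑ a ∈ range (N + 1), ∑ b ∈ range (N + 1),
          u mk * (shiftedEulerRapidityWeight x c mk.1 mk.2 a b * taylorCoeffAt x x (a, b) (zMono E j)) :=
        Finset.sum_comm
    _ = ∑ mk ∈ T, u mk * ∑ a ∈ range (N + 1), ∑ b ∈ range (N + 1),
          shiftedEulerRapidityWeight x c mk.1 mk.2 a b * taylorCoeffAt x x (a, b) (zMono E j) := by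
        refine Finset.sum_congr rfl fun mk _ => ?_
        rw [Finset.mul_sum]
        refine Finset.sum_congr rfl fun a _ => ?_
        rw [Finset.mul_sum]
    _ = ∑ mk ∈ T, u mk * (x ^ E * ((E - c) ^ mk.1 * hMoment mk.2 j)) :=
        Finset.sum_congr rfl fun mk hmk => by
          rw [sum_shiftedEulerRapidityWeight_taylorCoeffAt_zMono hx0 hx1 c hEj (hT mk hmk)]
    _ = x ^ E * ∑ mk ∈ T, u mk * ((E - c) ^ mk.1 * hMoment mk.2 j) := by
        rw [Finset.mul_sum]
        exact Finset.sum_congr rfl fun mk _ => by ring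

/-- The value `Σ u (E - c)^m hMoment k j` is non-negative for `u ≥ 0` and `E ≥ c`. [folklore] -/
theorem eulerMajorantValue_nonneg {T : Finset (ℕ × ℕ)} {u : ℕ × ℕ → ℝ} (hu : ∀ mk ∈ T, 0 ≤ u mk)
    {c E : ℝ} (hcE : c ≤ E) (j : ℕ) : 0 ≤ ∑ mk ∈ T, u mk * ((E - c) ^ mk.1 * hMoment mk.2 j) :=
  Finset.sum_nonneg fun mk hmk =>
    mul_nonneg (hu mk hmk) (mul_nonneg (pow_nonneg (by linarith) _) (hMoment_nonneg _ _))

/-- **At `x = ½` the q-sum of `Ψ_u` on a bare monomial is the `(E, h_k)` polynomial**: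
`qSum ψ_u (eulerIndexSet N) 0 0 E j = Σ u (E - c)^m hMoment k j` (`j ≤ E`, `m + 2k ≤ N` on `T`). [folklore] -/
theorem qSum_eulerMajorantWeight_zero_zero (c : ℝ) {E : ℝ} {j : ℕ} (hEj : (j : ℝ) ≤ E) {N : ℕ}
    {T : Finset (ℕ × ℕ)} (hT : ∀ mk ∈ T, mk.1 + 2 * mk.2 ≤ N) (u : ℕ × ℕ → ℝ) :
    qSum (eulerMajorantWeight (1 / 2) c T u) (eulerIndexSet N) 0 0 E j =
      ∑ mk ∈ T, u mk * ((E - c) ^ mk.1 * hMoment mk.2 j) := by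
  have h1 := sum_smul_taylorCoeffAt_zMono_half (eulerMajorantWeight (1 / 2) c T u) (eulerIndexSet N) E j hEj
  have h2 := sum_eulerMajorantWeight_taylorCoeffAt_zMono (x := 1 / 2) (by norm_num) (by norm_num) c hEj hT u
  have hE : (1 / 2 : ℝ) ^ E ≠ 0 := (Real.rpow_pos_of_pos (by norm_num) _).ne'
  rw [h1] at h2
  exact mul_left_cancel₀ hE h2

/-! ### (M̂) from coefficient domination -/

/-- `|Σ c b| ≤ Σ u b` for `|c| ≤ u` and `b ≥ 0`. [folklore] -/
theorem abs_sum_mul_le_of_dom {ι : Type*} (T : Finset ι) (c u b : ι → ℝ) (hb : ∀ i ∈ T, 0 ≤ b i)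
    (hdom : ∀ i ∈ T, |c i| ≤ u i) : |∑ i ∈ T, c i * b i| ≤ ∑ i ∈ T, u i * b i := by
  refine (Finset.abs_sum_le_sum_abs _ _).trans (Finset.sum_le_sum fun i hi => ?_)
  rw [abs_mul, abs_of_nonneg (hb i hi)]
  exact mul_le_mul_of_nonneg_right (hdom i hi) (hb i hi)

/-- **Obligation (M̂) for `Ψ_u` from coefficient domination.** If the row-3 q-sum has the expansion
`(½)^{Δσ+Δε} q̂₃(E,j) = Σ_{(m,k)∈T} c₃(m,k) (E - c)^m hMoment k j` at `(E, j)` with `E ≥ c`, `j ≤ E`, and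
`|c₃| ≤ u` on `T` (`m + 2k ≤ N` on `T`), then `(½)^{Δσ+Δε} |q̂₃(E,j)| ≤ qSum ψ_u (eulerIndexSet N) 0 0 E j` —
the hypothesis `hM` of `oddConeAt_half_of_qCone` for `Ψ_u`. [folklore] -/
theorem qM_half_of_eulerDomination (S : Finset (ℕ × ℕ)) (w : Fin 5 → ℕ × ℕ → ℝ) (c : ℝ) {N : ℕ}
    {T : Finset (ℕ × ℕ)} (hT : ∀ mk ∈ T, mk.1 + 2 * mk.2 ≤ N) (u c₃ : ℕ × ℕ → ℝ) (Δσ Δε E : ℝ) (j : ℕ)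
    (hEj : (j : ℝ) ≤ E) (hcE : c ≤ E)
    (hexp : (1 / 2 : ℝ) ^ (Δσ + Δε) * qSum (w 2) S ((Δσ + Δε) / 2) (-1) E j =
      ∑ mk ∈ T, c₃ mk * ((E - c) ^ mk.1 * hMoment mk.2 j))
    (hdom : ∀ mk ∈ T, |c₃ mk| ≤ u mk) :
    (1 / 2 : ℝ) ^ (Δσ + Δε) * |qSum (w 2) S ((Δσ + Δε) / 2) (-1) E j| ≤
      qSum (eulerMajorantWeight (1 / 2) c T u) (eulerIndexSet N) 0 0 E j := by
  have h0 : (0 : ℝ) < (1 / 2 : ℝ) ^ (Δσ + Δε) := Real.rpow_pos_of_pos (by norm_num) _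
  have habs : (1 / 2 : ℝ) ^ (Δσ + Δε) * |qSum (w 2) S ((Δσ + Δε) / 2) (-1) E j| =
      |(1 / 2 : ℝ) ^ (Δσ + Δε) * qSum (w 2) S ((Δσ + Δε) / 2) (-1) E j| := by
    rw [abs_mul, abs_of_pos h0]
  rw [qSum_eulerMajorantWeight_zero_zero c hEj hT u, habs, hexp]
  exact abs_sum_mul_le_of_dom T c₃ u _
    (fun mk _ => mul_nonneg (pow_nonneg (by linarith) _) (hMoment_nonneg _ _)) hdom

end Summit.CriticalPhenomena.Ising3D
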